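import Summits.Ventures.HodgeRepro2.A2CoefficientConjugation
import Summits.Ventures.HodgeRepro2.A2PontryaginConjugation
import Summits.Ventures.HodgeRepro2.A2PontryaginBigraded

/-!
# A2ModelConjugation — the complex conjugation of the model: an antilinear ring involution
exchanging the bidegrees and commuting with the Pontryagin product (up to the orientation sign)

Tier-4 annex of sub-claim A2 (seat p6, cell pub-hodge-repro2); §8(d): uses an L-value-free
non-vanishing device: NO.

Complex conjugation on `H^*(B, ℂ) = H^*(B, ℝ) ⊗ ℂ` is, in the eigenform basis `ℓ_τ, ℓ_τ̄` of
`H^1` (A4.2 / A0.3 (iii)), the composite of the swap `ℓ_τ ↔ ℓ_τ̄` (row 127's `swapA`) with the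
conjugation of the coefficients (row 131's `coeffConj`).  The model's version
`conjA := swapA ∘ coeffConj` is

* a `conj`-semilinear ring involution (`conjA_mul`, `conjA_conjA`; `swapA` and `coeffConj`
  commute, `swapA_coeffConj`);
* THE HODGE SYMMETRY: `conjA (hgrading a b) = hgrading b a` (`conjA_mem_hgrading`,
  `mem_hgrading_conjA_iff`) — the honest (antilinear) form of row 127's statement;
* compatible with the integral and the Pontryagin product up to the orientation sign `(−1)^n`
  (`integral_conjA`, `conjA_pontryagin`; exactly for the twelve planes);
* `conjA θ_c = −θ_{c̄}`: for real coefficients the (1,1)-class `i θ` is REAL (`conjA_I_smul_theta`),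
  as the Kähler form `(i/2) Σ dz ∧ dz̄`.

Real classes (`conjA x = x`) are closed under the cup product and, for even `n`, under `⋆`
(`conjA_mul_eq_self`, `conjA_pontryagin_eq_self`, `conjA_pontryagin_real_two_two`).  What stays
prose: the identification of `conjA` with complex conjugation
on `H^*(B, ℂ)` (and the rational structure, which the model does not carry: «Hodge class» =
rational + type `(k, k)` is prose); not on the N1 chain.
-/

namespace Summit.Ventures.HodgeRepro2.A2ModelConjugation

open WeilPlanes WeilIntegral WeilCoproduct A2ModelDuality A2PontryaginModel A2HodgeTypeModel
  A2HodgeBigrading A2HodgeSymmetry A2CoefficientConjugation A2PontryaginConjugation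

variable {ι : Type*} [DecidableEq ι] [Fintype ι]

/-- The complex conjugation of the model: the swap `a_p ↔ b_p` composed with the conjugation of
the coordinates in the monomial basis. -/
noncomputable def conjA : A ι →ₛₗ[starRingEnd ℂ] A ι := swapA.toLinearMap.comp coeffConj

omit [DecidableEq ι] in
/-- `conjA x = swapA (coeffConj x)`. -/
theorem conjA_apply (x : A ι) : conjA x = swapA (coeffConj x) := rfl

omit [DecidableEq ι] in
/-- `conjA` is antilinear. -/
theorem conjA_smul (c : ℂ) (x : A ι) : conjA (c • x) = (starRingEnd ℂ) c • conjA x :=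
  LinearMap.map_smulₛₗ _ _ _

/-- `conjA` is multiplicative. -/
theorem conjA_mul (x y : A ι) : conjA (x * y) = conjA x * conjA y := by
  rw [conjA_apply, conjA_apply, conjA_apply, coeffConj_mul, map_mul]

/-- `conjA 1 = 1`. -/
theorem conjA_one : conjA (1 : A ι) = 1 := by
  rw [conjA_apply, coeffConj_one, map_one]

/-- The swap fixes every basis monomial up to sign, hence commutes with the coefficient
conjugation. -/
theorem swapA_coeffConj (x : A ι) : swapA (coeffConj x) = coeffConj (swapA x) := by
  have h : (swapA.toLinearMap.comp coeffConj : A ι →ₛₗ[starRingEnd ℂ] A ι) =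
      coeffConj.comp swapA.toLinearMap := by
    refine aBasis.ext fun s => ?_
    simp only [LinearMap.comp_apply, AlgHom.toLinearMap_apply]
    rw [coeffConj_aBasis, aBasis_apply, swapA_mono]
    obtain ⟨ε, hε, hmono⟩ := exists_sign_mono_eq_aBasis
      ((A2LamAdjoint.genListOf_nodup s).map swapGen.injective)
    rw [hmono, coeffConj_sign_smul_aBasis hε]
  have := LinearMap.congr_fun h x
  simpa only [LinearMap.comp_apply, AlgHom.toLinearMap_apply] using this

/-- `conjA` is an involution. -/
theorem conjA_conjA (x : A ι) : conjA (conjA x) = x := by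
  rw [conjA_apply, conjA_apply, ← swapA_coeffConj, swapA_swapA, coeffConj_coeffConj]

/-- `conjA` is injective. -/
theorem conjA_injective : Function.Injective (conjA : A ι → A ι) :=
  Function.LeftInverse.injective conjA_conjA

/-- THE HODGE SYMMETRY: `conjA` maps `hgrading a b` into `hgrading b a`. -/
theorem conjA_mem_hgrading {a b : ℕ} {x : A ι} (hx : x ∈ hgrading a b) :
    conjA x ∈ hgrading b a := by
  rw [conjA_apply, ← map_hgrading a b]
  exact Submodule.mem_map_of_mem (coeffConj_mem_hgrading hx)

/-- `conjA x ∈ hgrading b a ⟺ x ∈ hgrading a b`. -/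
theorem mem_hgrading_conjA_iff {a b : ℕ} (x : A ι) :
    conjA x ∈ hgrading b a ↔ x ∈ hgrading a b := by
  refine ⟨fun h => ?_, conjA_mem_hgrading⟩
  have := conjA_mem_hgrading h
  rwa [conjA_conjA] at this

/-- `conjA` preserves the degree. -/
theorem conjA_mem_grading {k : ℕ} {x : A ι} (hx : x ∈ grading ι k) : conjA x ∈ grading ι k :=
  swapA_mem_grading (coeffConj_mem_grading hx)

/-- `∫_B (conjA x) = (−1)^n · conj (∫_B x)`: the orientation sign of the swap. -/
theorem integral_conjA (x : A ι) :
    integral (conjA x) = (-1 : ℂ) ^ Fintype.card ι * (starRingEnd ℂ) (integral x) := by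
  rw [conjA_apply, integral_swapA, integral_coeffConj]

/-- THE PONTRYAGIN PRODUCT COMMUTES WITH COMPLEX CONJUGATION UP TO THE ORIENTATION SIGN:
`conjA (z ⋆ x) = (−1)^n • (conjA z ⋆ conjA x)`. -/
theorem conjA_pontryagin (z x : A ι) :
    conjA (pontryagin z x) = (-1 : ℂ) ^ Fintype.card ι • pontryagin (conjA z) (conjA x) := by
  rw [conjA_apply, coeffConj_pontryagin, swapA_pontryagin, conjA_apply, conjA_apply]

/-- The twelve-plane instance: `conjA (z ⋆ x) = conjA z ⋆ conjA x`. -/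
theorem conjA_pontryagin_twelve (z x : A A2TwelvePlanes.ι₁₂) :
    conjA (pontryagin z x) = pontryagin (conjA z) (conjA x) := by
  rw [conjA_pontryagin, A2TwelvePlanes.card_twelve]
  norm_num

/-- `coeffConj E_p = E_p` (a basis monomial up to sign). -/
theorem coeffConj_E (p : ι) : coeffConj (E p) = E p := by
  have h : E p = mono [(p, false), (p, true)] := by simp [E, mono]
  have hnd : [(p, false), (p, true)].Nodup := by simp
  obtain ⟨ε, hε, hmono⟩ := exists_sign_mono_eq_aBasis hnd
  rw [h, hmono, coeffConj_sign_smul_aBasis hε]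

/-- `conjA E_p = −E_p`. -/
theorem conjA_E (p : ι) : conjA (E p) = -E p := by
  rw [conjA_apply, coeffConj_E, swapA_E]

/-- `conjA θ_c = −θ_{c̄}`: the coefficients are conjugated and every plane reversed. -/
theorem conjA_theta (c : ι → ℂ) : conjA (theta c) = -theta fun p => (starRingEnd ℂ) (c p) := by
  simp only [theta, map_sum, conjA_smul, conjA_E, smul_neg, Finset.sum_neg_distrib]

/-- `i θ_c` is REAL (fixed by `conjA`) for real coefficients `c` — as the Kähler form
`(i/2) Σ dz ∧ dz̄`. -/
theorem conjA_I_smul_theta (c : ι → ℝ) :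
    conjA (Complex.I • theta fun p => ((c p : ℝ) : ℂ)) = Complex.I • theta fun p => ((c p : ℝ) : ℂ) := by
  rw [conjA_smul, conjA_theta, Complex.conj_I, neg_smul, smul_neg, neg_neg]
  congr 2
  funext p
  exact Complex.conj_ofReal (c p)

/-- Real classes (`conjA x = x`) are closed under the cup product. -/
theorem conjA_mul_eq_self {x y : A ι} (hx : conjA x = x) (hy : conjA y = y) :
    conjA (x * y) = x * y := by
  rw [conjA_mul, hx, hy]

/-- Real classes are closed under the Pontryagin product when `n` is even. -/
theorem conjA_pontryagin_eq_self (hn : Even (Fintype.card ι)) {z x : A ι} (hz : conjA z = z)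
    (hx : conjA x = x) : conjA (pontryagin z x) = pontryagin z x := by
  rw [conjA_pontryagin, hz, hx, hn.neg_one_pow, one_smul]

/-- Twelve planes: the Pontryagin product of a real `(10,10)`-class and a real `(4,4)`-class is a
real `(2,2)`-class (the model's «real (k, k)-class»; the rational structure, hence «Hodge class»,
stays prose). -/
theorem conjA_pontryagin_real_two_two {z x : A A2TwelvePlanes.ι₁₂} (hz : conjA z = z)
    (hz' : z ∈ hgrading 10 10) (hx : conjA x = x) (hx' : x ∈ hgrading 4 4) :
    conjA (pontryagin z x) = pontryagin z x ∧ pontryagin z x ∈ hgrading 2 2 :=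
  ⟨conjA_pontryagin_eq_self ⟨6, by rw [A2TwelvePlanes.card_twelve]⟩ hz hx,
    A2PontryaginBigraded.pontryagin_mem_two_two hz' hx'⟩

end Summit.Ventures.HodgeRepro2.A2ModelConjugation
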